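/-
Copyright (c) 2026 the pub-hodgecm-mathlib formalisation cell (harness21).  Prover seat hodgecm-mathlib-F0P3a-p07 (g11): road «S3-tree» (LEAD F0P3a-plan (g11), architect
A-p16 (g29) ruling A-87 (2) «(c″-F1) RAMIFIED GOOD-REDUCTION FRAME», second half: residual isotropy by Chevalley–Warning), brick «SPAN-0-ram»; 2026-09-01.
-/
import Literature.NumberTheory.Automorphic.UnitaryLatticeTreeResiduallyUnipotentCorner   -- ★ p845859 (this seat): `residue_eq_zero_iff_v_lt_one`, `residue_eq_of_v_sub_lt_one`; brings `pairing`, `stdLattice`, `IsIntMatrix`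
import Mathlib.FieldTheory.ChevalleyWarning
import HarnessLib

/-!
# The lattice graph of a hermitian space — RESIDUAL ISOTROPY OF A TERNARY HERMITIAN FORM OVER A FINITE RESIDUE FIELD WITH TRIVIAL RESIDUAL INVOLUTION (Chevalley–Warning)
# (Chevalley 1935 ∕ Warning 1935; Serre, *Cours d'arithmétique* I §2; Jacobowitz 1962 §8)

Topic `NumberTheory/Automorphic`; namespace `Literature.NumberTheory.Automorphic.UnitaryLatticeTree`.  THEOREMS ONLY (no definition, no instance, no notation, no named fact,
no `sorry`); kernel lane.  Cell `pub/hodgecm-mathlib` (D-0151), crux H413 = `stmt-HodgeConjecture-24833`; road «S3-tree», brick **«SPAN-0-ram» (c″-F1b)** (architect A-87 (2)):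
the residual-isotropy input of ★ `exists_glInt_eq_smul_formCongr_antidiagonal_of_isotropic` (★ p07 `UnitaryLatticeTreeUnimodularFrame`) at a RAMIFIED place.
THE MATHEMATICS.  `K` valued with FINITE residue field `𝓀`, `σ` acting trivially on `𝓀` (`|σx − x| < 1` on `𝒪` — a ramified place), `H ∈ M₃(𝒪)`.  The residual form
`x̄ ↦ Σ H̄ᵢⱼ x̄ᵢ x̄ⱼ` is a QUADRATIC form in `3` variables over the finite field `𝓀` (the involution is invisible residually), of total degree `2 < 3`; by CHEVALLEY–WARNING
(Mathlib `char_dvd_card_solutions`) the number of its zeros in `𝓀³` is divisible by `p = char 𝓀`, and `0` is a zero, so there is a zero `x̄ ≠ 0`; any lift `x ∈ 𝒪³` is PRIMITIVE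
(a unit coordinate) with `|h(x,x)| < 1`.  No unimodularity of `H` is needed.
HONEST LABEL: HC_CM is proved only modulo the 2 remaining named inputs (hLiu418 24832, h413 24833) until rung 0 closes; nothing printed is asserted here (finite-field
combinatorics + residue arithmetic); S3 (`stub_N6nsS3id`) stays a print row until the road's END lands.

* §1 **`exists_primitive_v_pairing_self_lt_one`** (residual isotropy at a place with finite residue field and trivial residual involution).

## References
* [Serre1973CourseArithmetic] J.-P. Serre, *A Course in Arithmetic* (1973), Ch. I §2 Thm. 3 (Chevalley–Warning) and its Cor. 2 (quadratic forms in ≥ 3 variables over a finite field have a non-trivial zero).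
* [Jacobowitz1962] R. Jacobowitz, *Hermitian forms over local fields*, Amer. J. Math. 84 (1962), §8 (ramified places: the residual form is symmetric bilinear).
-/

set_option autoImplicit false

noncomputable section

open scoped Valued WithZero Matrix MatrixGroups
open MvPolynomial

namespace Literature.NumberTheory.Automorphic.UnitaryLatticeTree

open Literature.NumberTheory.Automorphic Literature.NumberTheory.Automorphic.HermitianLattice

variable {K : Type*} [Field K] [Valued K ℤᵐ⁰] {σ : K →+* K}

/-- **RESIDUAL ISOTROPY (Chevalley–Warning)**: if the residue field of `K` is finite, `σ` acts trivially on it (`|σx − x| < 1` for `|x| ≤ 1`) and `H ∈ M₃(𝒪)`, then some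
PRIMITIVE integral vector `x` (a unit coordinate) has `|h(x, x)| < 1`, `h(x,x) = Σ σ(xᵢ)Hᵢⱼxⱼ`: the residual form is a ternary QUADRATIC form over the finite field `𝓀`, which
has a non-trivial zero since `char 𝓀` divides the number of zeros (total degree `2 < 3` variables) and `0` is one. [cite: Serre1973CourseArithmetic, Ch. I §2 Thm. 3, Cor. 2] [cite: Jacobowitz1962, §8] -/
theorem exists_primitive_v_pairing_self_lt_one [Finite 𝓀[K]] (hres : ∀ x : K, Valued.v x ≤ 1 → Valued.v (σ x - x) < 1)
    {H : Matrix (Fin 3) (Fin 3) K} (hH : IsIntMatrix H) :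
    ∃ x : Fin 3 → K, x ∈ stdLattice K 3 ∧ (∃ i, Valued.v (x i) = 1) ∧ Valued.v (pairing σ H x x) < 1 := by
  classical
  haveI : Fintype 𝓀[K] := Fintype.ofFinite _
  obtain ⟨p, hp⟩ := CharP.exists 𝓀[K]
  haveI := hp
  have hpprime : p.Prime := CharP.char_is_prime 𝓀[K] p
  have memO : ∀ {x : K}, Valued.v x ≤ 1 → x ∈ 𝒪[K] := fun hx => (Valuation.mem_valuationSubring_iff _ _).2 hx
  -- the residual matrix and the residual quadratic form
  set HO : Matrix (Fin 3) (Fin 3) 𝒪[K] := Matrix.of fun i j => (⟨H i j, memO (hH i j)⟩ : 𝒪[K]) with hHO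
  set Hb : Matrix (Fin 3) (Fin 3) 𝓀[K] := HO.map (IsLocalRing.residue 𝒪[K]) with hHb
  set f : MvPolynomial (Fin 3) 𝓀[K] := ∑ i, ∑ j, C (Hb i j) * X i * X j with hf
  have heval : ∀ z : Fin 3 → 𝓀[K], eval z f = ∑ i, ∑ j, Hb i j * z i * z j := by
    intro z
    simp only [hf, map_sum, map_mul, eval_C, eval_X]
  -- total degree `≤ 2 < 3`
  have hdeg : f.totalDegree < Fintype.card (Fin 3) := by
    rw [Fintype.card_fin]
    refine lt_of_le_of_lt ?_ (by norm_num : 2 < 3)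
    refine (totalDegree_finsetSum _ _).trans (Finset.sup_le fun i _ => (totalDegree_finsetSum _ _).trans (Finset.sup_le fun j _ => ?_))
    calc (C (Hb i j) * X i * X j).totalDegree ≤ (C (Hb i j) * X i).totalDegree + (X j : MvPolynomial (Fin 3) 𝓀[K]).totalDegree := totalDegree_mul _ _
      _ ≤ ((C (Hb i j) : MvPolynomial (Fin 3) 𝓀[K]).totalDegree + (X i : MvPolynomial (Fin 3) 𝓀[K]).totalDegree) + (X j : MvPolynomial (Fin 3) 𝓀[K]).totalDegree := by
          gcongr; exact totalDegree_mul _ _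
      _ ≤ (0 + 1) + 1 := by
          gcongr
          · exact (totalDegree_C _).le
          · exact (totalDegree_X _).le
          · exact (totalDegree_X _).le
      _ = 2 := by norm_num
  -- Chevalley–Warning: `p ∣ #zeros`; `0` is a zero, so there is a non-zero one
  have hdvd := char_dvd_card_solutions p hdeg
  obtain ⟨z, hz, hz0⟩ : ∃ z : Fin 3 → 𝓀[K], eval z f = 0 ∧ z ≠ 0 := by
    by_contra hcon
    push Not at hcon
    have hcard : Fintype.card {z : Fin 3 → 𝓀[K] // eval z f = 0} = 1 := by
      rw [Fintype.card_eq_one_iff]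
      refine ⟨⟨0, by rw [heval]; simp⟩, fun ⟨z, hz⟩ => Subtype.ext (hcon z hz)⟩
    rw [hcard, Nat.dvd_one] at hdvd
    exact hpprime.one_lt.ne' hdvd
  -- lift `z` to `𝒪³`
  obtain ⟨i₀, hi₀⟩ : ∃ i, z i ≠ 0 := by
    by_contra h
    push Not at h
    exact hz0 (funext h)
  choose a ha using fun i => IsLocalRing.residue_surjective (z i)
  refine ⟨fun i => (a i : K), fun i => (a i).2, ⟨i₀, ?_⟩, ?_⟩
  · -- a lift of a non-zero residue is a unit
    have hne : IsLocalRing.residue 𝒪[K] (a i₀) ≠ 0 := by rw [ha]; exact hi₀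
    rw [Ne, residue_eq_zero_iff_v_lt_one, not_lt] at hne
    exact le_antisymm (a i₀).2 hne
  · -- `h(x, x) ≡ Σ H̄ᵢⱼ z̄ᵢ z̄ⱼ = 0 (mod 𝔪)` since `σ̄ = id`
    have hσa : ∀ i, Valued.v (σ (a i : K)) ≤ 1 := fun i => by
      have h := hres _ (a i).2
      calc Valued.v (σ (a i : K)) = Valued.v ((σ (a i : K) - a i) + a i) := by rw [sub_add_cancel]
        _ ≤ max (Valued.v (σ (a i : K) - a i)) (Valued.v (a i : K)) := Valuation.map_add _ _ _
        _ ≤ 1 := max_le h.le (a i).2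
    have hres' : ∀ i, IsLocalRing.residue 𝒪[K] ⟨σ (a i : K), memO (hσa i)⟩ = z i := fun i => by
      rw [← ha i]
      exact residue_eq_of_v_sub_lt_one (hres _ (a i).2)
    set S : 𝒪[K] := ∑ i, ∑ j, (⟨σ (a i : K), memO (hσa i)⟩ : 𝒪[K]) * HO i j * a j with hS
    have hSval : (S : K) = pairing σ H (fun i => (a i : K)) (fun i => (a i : K)) := by
      rw [pairing_apply, hS]
      push_cast
      rfl
    have hSres : IsLocalRing.residue 𝒪[K] S = 0 := by
      rw [hS, map_sum]
      simp only [map_sum, map_mul, hres', ha]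
      rw [← hz, heval]
      refine Finset.sum_congr rfl fun i _ => Finset.sum_congr rfl fun j _ => ?_
      rw [hHb, Matrix.map_apply]; ring
    rw [← hSval, ← residue_eq_zero_iff_v_lt_one]
    exact hSres

end Literature.NumberTheory.Automorphic.UnitaryLatticeTree

end
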